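import Summits.ABC.ABC.Theorems.DefiniteXiFreyModularityStubNineTransfer
import HarnessLib

/-!
# Stub ideas `stub_threeImpTwo` (k1, gen 15): semistability at `p ≠ ℓ` transfers along `E[ℓ] ≅ E'[ℓ]`

Companion of `STUB-IDEAS-stub_threeImpTwo-1.md` (crux `FreyModularity`, stmt-ABC-11340).
H10 of the plan, generalised: for `ℓ ≥ 5` prime, a prime `p ≠ ℓ`, and elliptic curves `E, E'/ℚ`
with a common framed model of `E[ℓ]` and `E'[ℓ]`, `p² ∤ N_E ⇒ p² ∤ N_{E'}` (Silverberg, CSS 1997,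
Prop. 7.1, general form).  The proof is the tree's `stub_nineTransfer` (the case `p = 3`, `ℓ = 5`)
verbatim with `3 ↦ p`, `5 ↦ ℓ`.  Corollary `fourTransfer` (`p = 2`, `ℓ = 5`): on normalised
case-B Frey pairs the switched curve `W'` of call site I2 is semistable at `2`, so the pointwise
closer H8 (`…_pointwise_of_not_additive_two`) applies there with NO Saito-at-2 leaf.
-/

set_option linter.dupNamespace false

noncomputable section

open scoped MatrixGroups NumberField

open Matrix Field IsDedekindDomain
open Literature.NumberTheory.EllipticCurves
open Literature.NumberTheory.Automorphic
open Literature.NumberTheory.Automorphic.BCDT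
open Literature.NumberTheory.GaloisRepresentations
open Literature.NumberTheory.DiophantineGeometry
open WeierstrassCurve
open Summit.ABC.ABC.Theorems

namespace Summit.ABC.ABC.Cruxes.FreyModularity.Sketch.StubIdeasThreeImpTwo1G15

/-- **Semistability at `p ≠ ℓ` transfers along a common framed model of the `ℓ`-torsion**
(`ℓ ≥ 5`): if `E[ℓ] ≅ E'[ℓ]` as `Γ_ℚ`-modules and `p² ∤ N_E` then `p² ∤ N_{E'}`.
Proof as `stub_nineTransfer`: `E` is good or multiplicative at `p`, so `I_p` fixes a non-zero
`ℓ`-torsion point of `E`, hence of `E'`; if `E'` were additive at `p`, `E'[ℓ]^{I_p} = 0`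
(`stub_nineTransfer_torsion`, `c_p(E') ≤ 4 < ℓ`). [cite: SilverbergCSS1997, Prop. 7.1] -/
theorem not_sq_dvd_conductorNorm_of_isTorsionGaloisRep
    (W W' : WeierstrassCurve ℚ) [W.IsElliptic] [W'.IsElliptic] {ℓ : ℕ} [Fact ℓ.Prime] (hℓ4 : 4 < ℓ)
    (ρ : ModPGaloisRep ℚ (ZMod ℓ) 2) (hρ : W.IsTorsionGaloisRep ℓ ρ) (hρ' : W'.IsTorsionGaloisRep ℓ ρ)
    {p : ℕ} (hp : p.Prime) (hpℓ : p ≠ ℓ) (hW2 : ¬ p ^ 2 ∣ W.conductorNorm ℤ) :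
    ¬ p ^ 2 ∣ W'.conductorNorm ℤ := by
  intro hW'2
  classical
  have hℓp : ℓ.Prime := Fact.out
  set v : HeightOneSpectrum (𝓞 ℚ) :=
    (Rat.HeightOneSpectrum.primesEquiv (R := 𝓞 ℚ)).symm ⟨p, hp⟩ with hv
  have hvp : (Rat.HeightOneSpectrum.primesEquiv v : ℕ) = p := by rw [hv, Equiv.apply_symm_apply]
  have hℓv : ((ℓ : ℕ) : 𝓞 ℚ) ∉ v.asIdeal := by
    rw [natCast_mem_asIdeal_iff_eq_primesEquiv_symm v hℓp, hv,
      (Rat.HeightOneSpectrum.primesEquiv (R := 𝓞 ℚ)).symm.injective.eq_iff]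
    intro h
    exact hpℓ (congrArg Subtype.val h)
  obtain ⟨𝔓, h𝔓⟩ := HeightOneSpectrum.primesAbove_nonempty v
  have hW : ¬ W.HasAdditiveReductionAt v := by
    rw [← sq_dvd_conductorNorm_iff_hasAdditiveReductionAt W hp hvp]
    exact hW2
  have hW' : W'.HasAdditiveReductionAt v := by
    rw [← sq_dvd_conductorNorm_iff_hasAdditiveReductionAt W' hp hvp]
    exact hW'2
  obtain ⟨P₀, hP₀0, hP₀ℓ, hP₀fix⟩ :=
    exists_ne_zero_smul_eq_of_not_hasAdditiveReductionAt W ℓ hℓv hW h𝔓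
  set P : geomTorsion W ((ℓ : ℕ) : ℤ) := ⟨P₀, AddSubgroup.torsionBy.nsmul_iff.mpr hP₀ℓ⟩ with hPdef
  obtain ⟨P', hP'0, hP'fix⟩ := exists_torsion_of_isTorsionGaloisRep hρ hρ' P
  have hPfix : ∀ σ ∈ 𝔓.inertia (absoluteGaloisGroup ℚ), σ • P = P := fun σ hσ ↦
    Subtype.ext (by rw [AddSubgroup.torsionBy.coe_smul]; exact hP₀fix σ hσ)
  have hP'ℓ : ℓ • (P' : geomPoints W') = 0 := AddSubgroup.torsionBy.nsmul_iff.mp P'.2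
  have hP'zero : (P' : geomPoints W') = 0 :=
    stub_nineTransfer_torsion W' hℓp hℓ4 hℓv hW' h𝔓 (P' : geomPoints W') hP'ℓ
      (fun σ hσ ↦ by rw [← AddSubgroup.torsionBy.coe_smul, hP'fix σ (hPfix σ hσ)])
  have hP'eq : P' = 0 := Subtype.ext hP'zero
  have hPeq : P = 0 := hP'0.mp hP'eq
  exact hP₀0 (congrArg Subtype.val hPeq)

/-- **H10 `fourTransfer`** — the `p = 2` twin of the closed stub `stub_nineTransfer`: along
`E[5] ≅ E'[5]`, `4 ∤ N_E ⇒ 4 ∤ N_{E'}`. [cite: SilverbergCSS1997, Prop. 7.1] -/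
theorem fourTransfer :
    ∀ (W W' : WeierstrassCurve ℚ) [W.IsElliptic] [W'.IsElliptic] (ρ : ModPGaloisRep ℚ (ZMod 5) 2),
      W.IsTorsionGaloisRep 5 ρ → W'.IsTorsionGaloisRep 5 ρ →
      ¬ 4 ∣ W.conductorNorm ℤ → ¬ 4 ∣ W'.conductorNorm ℤ := by
  intro W W' _ _ ρ hρ hρ' h4
  haveI : Fact (Nat.Prime 5) := ⟨Nat.prime_five⟩
  have h := not_sq_dvd_conductorNorm_of_isTorsionGaloisRep W W' (ℓ := 5) (by norm_num) ρ hρ hρ'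
    Nat.prime_two (by norm_num) (by simpa using h4)
  simpa using h

/-- Sanity: the tree's `stub_nineTransfer` is the case `p = 3`, `ℓ = 5`. [folklore] -/
theorem nineTransfer' :
    ∀ (W W' : WeierstrassCurve ℚ) [W.IsElliptic] [W'.IsElliptic] (ρ : ModPGaloisRep ℚ (ZMod 5) 2),
      W.IsTorsionGaloisRep 5 ρ → W'.IsTorsionGaloisRep 5 ρ →
      ¬ 9 ∣ W.conductorNorm ℤ → ¬ 9 ∣ W'.conductorNorm ℤ := by
  intro W W' _ _ ρ hρ hρ' h9
  haveI : Fact (Nat.Prime 5) := ⟨Nat.prime_five⟩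
  have h := not_sq_dvd_conductorNorm_of_isTorsionGaloisRep W W' (ℓ := 5) (by norm_num) ρ hρ hρ'
    Nat.prime_three (by norm_num) (by simpa using h9)
  simpa using h

/-- **Squarefree-away-from-`ℓ` transfer**: if `E[ℓ] ≅ E'[ℓ]` (`ℓ ≥ 5`) and `N_E` is not divisible
by `p²` for any prime `p ≠ ℓ`, the same holds for `N_{E'}` — semistability away from `ℓ` is read
off from `E[ℓ]`. [cite: SilverbergCSS1997, Prop. 7.1] -/
theorem forall_not_sq_dvd_conductorNorm_of_isTorsionGaloisRep
    (W W' : WeierstrassCurve ℚ) [W.IsElliptic] [W'.IsElliptic] {ℓ : ℕ} [Fact ℓ.Prime] (hℓ4 : 4 < ℓ)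
    (ρ : ModPGaloisRep ℚ (ZMod ℓ) 2) (hρ : W.IsTorsionGaloisRep ℓ ρ) (hρ' : W'.IsTorsionGaloisRep ℓ ρ)
    (h : ∀ p : ℕ, p.Prime → p ≠ ℓ → ¬ p ^ 2 ∣ W.conductorNorm ℤ) :
    ∀ p : ℕ, p.Prime → p ≠ ℓ → ¬ p ^ 2 ∣ W'.conductorNorm ℤ :=
  fun p hp hpℓ ↦ not_sq_dvd_conductorNorm_of_isTorsionGaloisRep W W' hℓ4 ρ hρ hρ' hp hpℓ (h p hp hpℓ)

/-! ## H11: `4 ∤ N_E` ⇒ no additive reduction above `2` (the hypothesis `h2` of the pointwise,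
Saito-free level-`=`-conductor theorem
`IsNewformOf.level_eq_conductorNorm_of_carayol_of_forall_not_hasAdditiveReductionAt_two`) -/

/-- **H11.** If `4 ∤ N_E` then `E` is not of additive reduction at any place of residue
characteristic `2` (`2² ∣ N_E ⟺` additive at the place over `2`,
`sq_dvd_conductorNorm_iff_hasAdditiveReductionAt`). [cite: SilvermanATAEC1994, Thm. IV.10.2(a)] -/
theorem forall_not_hasAdditiveReductionAt_of_not_four_dvd (W : WeierstrassCurve ℚ) [W.IsElliptic]
    (h4 : ¬ 4 ∣ W.conductorNorm ℤ) :
    ∀ w : HeightOneSpectrum (𝓞 ℚ), ringChar (𝓞 ℚ ⧸ w.asIdeal) = 2 → ¬ W.HasAdditiveReductionAt w := by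
  intro w h2 hadd
  classical
  have h20 : ((2 : ℕ) : 𝓞 ℚ ⧸ w.asIdeal) = 0 := by rw [ringChar.spec, h2]
  have hmem : ((2 : ℕ) : 𝓞 ℚ) ∈ w.asIdeal := by
    rw [← Ideal.Quotient.eq_zero_iff_mem, map_natCast]
    exact h20
  rw [natCast_mem_asIdeal_iff_eq_primesEquiv_symm w Nat.prime_two] at hmem
  have hw2 : (Rat.HeightOneSpectrum.primesEquiv w : ℕ) = 2 := by
    rw [hmem, Equiv.apply_symm_apply]
  have h := (sq_dvd_conductorNorm_iff_hasAdditiveReductionAt W Nat.prime_two hw2).mpr hadd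
  exact h4 (by simpa using h)

/-- **Call site I2 (the switched curve).** Along `E[5] ≅ W'[5]`, `4 ∤ N_E` makes `W'` free of
additive reduction above `2` — the hypothesis `h2` of the Saito-free pointwise closer H8
(`isModular_of_isModularGaloisRepTate_pointwise_of_not_additive_two`, companion `…_1g9.lean`).
[cite: SilverbergCSS1997, Prop. 7.1] -/
theorem forall_not_hasAdditiveReductionAt_two_of_isTorsionGaloisRep_five
    (W W' : WeierstrassCurve ℚ) [W.IsElliptic] [W'.IsElliptic] (ρ : ModPGaloisRep ℚ (ZMod 5) 2)
    (hρ : W.IsTorsionGaloisRep 5 ρ) (hρ' : W'.IsTorsionGaloisRep 5 ρ) (h4 : ¬ 4 ∣ W.conductorNorm ℤ) :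
    ∀ w : HeightOneSpectrum (𝓞 ℚ), ringChar (𝓞 ℚ ⧸ w.asIdeal) = 2 → ¬ W'.HasAdditiveReductionAt w :=
  forall_not_hasAdditiveReductionAt_of_not_four_dvd W' (fourTransfer W W' ρ hρ hρ' h4)

end Summit.ABC.ABC.Cruxes.FreyModularity.Sketch.StubIdeasThreeImpTwo1G15

end
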